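import Summits.QuantumFields.YangMills.Theorems.BalabanUVNodesN15CurvedPerturbationLettersSpecies
import Summits.QuantumFields.YangMills.Theorems.BalabanUVNodesN15CurvedGluingCubeDressedGeneralGaugeUN
import Summits.QuantumFields.YangMills.Theorems.BalabanUVNodesN15CurvedTransporterOrthogonalityUN
import HarnessLib

/-!
# Route «BalabanUVNodes» (cluster K4 «SpineRates»), Track-A DAG node N15 = NE2, BACKGROUND LAYER — THE PERTURBATION SLOTS `hV` ∕ `hDV` OF THE LIVE-BACKGROUND CUBE DEVICE INHABITED
# BY GENUINE `U(N)`-VALUED LATTICE GAUGE FIELDS: GROUP-LEVEL transporter letters for `S_μ(x) = coordMat e (Ad_{U_μ(x)})` read off the BOND VARIABLES (`‖U − 1‖_F`, the covariant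
# backward difference `‖U_μ(x) − V₋ᴴU₋V₋‖_F` — no generator, no logarithm), the knit at a curved `U(N)` base point and around `U ≡ 1`, and the `𝔲(N)` generator-level two-grid defect

Cell `pub-ymgap`, seat `pub-ymgap-dag-n15-w2` (WIDTH SEAT 2∕3 on node N15, director-ym №197 ∕ HUMAN RULING D-0149), g5, second piece (bus CLAIM-2, same window as CLAIM-1 I.37203) — the
`U(N)` edition of `…CurvedPerturbationLettersSpecies` in this seat's g2∕g4 lineage.  `bears_on: R4∕N15 · K3⁸ SpineGivenEndpointR13SepCoPHV (stmt-QuantumFields-27366)`.  Filed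
`--kind proof --supports stmt-QuantumFields-27366 --as helper` — COUNT-NEUTRAL.  Theorems only; 0 `def`, 0 `sorry`.  Imports BY NAME this seat's `…CurvedPerturbationLettersSpecies`
(`hasMaj_unstackM_curvCoef_rate`, `hasMaj_unstackM_tCoef_gaugePair_rate`, `hasMaj_unstackM_curvCoef_exp_rate_of_skew`, `hasMaj_idef_unstackM_curvCoef_exp_rate_of_skew`), g4
`…CurvedGluingCubeDressedGeneralGaugeUN` (`uN_opNorm_conj_sub_conj_le`, `uN_frobenius_norm_of_unitary`; through it g2 `…N15AdjointGaugeAction`: `coordMat_mulLeftRight_mul`,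
`mulLeftRight_one_one`, `uN_siteGauge_transpose_eq`; `…N15AdjointTransportExp`: `uN_coordMat_conj_orthogonal`), g2 `…CurvedTransporterOrthogonalityUN`
(`coordMat_adCLM_transpose_eq_neg_of_conjTranspose`), n15-w3 file 5 (`abs_coordMat_sub_entry_le`), n15-b part 16 (`coordMat`, `basisConst`, `coordMat_one`); nothing in the tree is
modified, no landed name re-declared.

WHY.  (3.35) p. 396 of [Balaban1985BackgroundPropagators] hands the propagator construction, cube by cube, a GENUINE lattice gauge field: bond variables `U_μ(x) ∈ G = U(N)` close to `1`
in the cube's gauge, acting on `𝔤`-valued fields through the adjoint representation — in trace-form-orthonormal real coordinates `e` of `M_N(ℂ)` the transporter field of dag-n15-w3's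
curved species is `S_μ(x) = coordMat e (Ad_{U_μ(x)})`, `Ad_u X = uXuᴴ` (this seat's g2: orthogonal on both sides for unitary `u`).  `…CurvedPerturbationLettersSpecies` turns file 1's
ENTRYWISE transporter letters into the device's `hV`∕`hDV`; THIS FILE reads those entrywise letters off the bond variables themselves:
* §1 ★ `uN_abs_coordMat_conj_sub_entry_le` (`|coordMat e (Ad_{u′}) − coordMat e (Ad_u)|_{ij} ≤ κ_e·2√|n|·‖u′ − u‖_F` for unitary `u, u′`), ★ `uN_transporterLetter_group`
  (`|S_μ(x) − 1|_{ij} ≤ η·(κ_e·2√|n|·a)` from `‖U_μ(x) − 1‖_F ≤ ηa`), ★★ `uN_covShiftDefect_conj_eq` (at a `U(N)` base point `R_μ = coordMat e (Ad_{V_μ})` the covariant backward defect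
  IS `coordMat e (Ad_{U_μ(x)}) − coordMat e (Ad_{V₋ᴴU₋V₋})`, `U₋ = U_μ(x − e_μ)`, `V₋ = V_μ(x − e_μ)` — `Ad` is a homomorphism and `R₋ᵀ = coordMat e (Ad_{V₋ᴴ})`),
  ★★ `uN_covShiftLetter_group` (`|S_μ − R₋ᵀS₋R₋|_{ij} ≤ η²·(κ_e·2√|n|·b)` from the group-level covariant backward difference `‖U_μ(x) − V₋ᴴU₋V₋‖_F ≤ η²b`);
* §2 ★★★ `uN_hasMaj_unstackM_curvCoef_group_rate` — `hV` for the curved species at a genuine `U(N)` pair (perturbation `U`, background `V`), NO model hypothesis: letters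
  `r_V(κ_e 2√|n| a, κ_e 2√|n| b)(1 + |J ⊕ J|)·e^{−δ_Vd}` for every `δ_V`; ★★ `uN_hasMaj_unstackM_tCoef_gaugePair_group_rate` — around `U ≡ 1` (the species edition of files 20–23) from
  `‖U − 1‖_F ≤ ηa` and the plain backward difference `‖U_μ(x) − U_μ(x − e_μ)‖_F ≤ η²b`;
* §3 generator level for `𝔲(N)`-valued potentials `A` (perturbation), `B` (background) — `Z = ad∘A`, `W = ad∘B`, skewness by g2: ★★ `uN_hasMaj_unstackM_curvCoef_exp_rate` (one grid) and
  ★★★ `uN_hasMaj_idef_unstackM_curvCoef_exp_rate` (two grids: the device's `hDV` from the potentials' sizes, lattice gradients and two-grid fits ONLY).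

HONEST FRAMING ∕ LIMITS.  Finite-dimensional linear algebra + block-majorant bookkeeping over DISPLAYED bond-variable ∕ potential letters ((3.35)–(3.37) p. 396, (3.50)–(3.53)
p. 400 = SHAPES); nothing of [B5]∕[B6]∕[B9] asserted; the local gauges `u_□` of (3.35) (axial ∕ Sect.-F gauges) and the flat cube data are NOT produced here (lane-held); the
two-grid defect at pure group level would need a rescaled group-level fit and is typed only at generator level (§3).  NE2⁺ NOT PRINTED, NOT proved; N15 NOT discharged; K3⁸ OPEN,
not claimed, skeleton v6 untouched; counts of record UNMOVED (typed 28∕28 · discharged 5∕27 · A 5∕28); no summit statement is proved here; one finite 𝕋⁴ at fixed ε — NOT ℝ⁴ ∕ OS ∕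
mass gap ∕ Clay; R4 closes the conditional finite-𝕋⁴ rung `BalabanLadder.UV` only.  Restate-immune (no Theses import).
-/

set_option autoImplicit false

noncomputable section
open scoped BigOperators Matrix Matrix.Norms.Frobenius
open Finset

namespace Summit.QuantumFields.YangMills.BalabanUVNodes.N15.CurvedSpecies

open Literature.MathematicalPhysics.QuantumFieldTheory.Balaban1983to89
open Literature.MathematicalPhysics.QuantumFieldTheory.Balaban1983to89.B11SectG (BlockNorm HasMaj)
open Literature.MathematicalPhysics.QuantumFieldTheory.Balaban1983to89.T4EtaRateDefect (idef)
open Literature.MathematicalPhysics.QuantumFieldTheory.Balaban1983to89.T4EtaRateCoeffDefect (pull)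
open Literature.MathematicalPhysics.QuantumFieldTheory.Balaban1983to89.Beta.AveragingCorrectionJets (adCLM)
open Summit.QuantumFields.YangMills.BalabanUVNodes.N15.MatrixSpecies (liftMap liftBlk coordMat basisConst basisConst_nonneg)
open Summit.QuantumFields.YangMills.BalabanUVNodes.N15.BackgroundLayer (liftPair blkPair tCoefA tCoefC unstackM coordMat_one)
open Literature.Barriers.QuantumFields (traceForm)

variable {n : Type} [Fintype n] [DecidableEq n] {κ : Type} [Fintype κ] [DecidableEq κ] (e : Matrix n n ℂ ≃L[ℝ] (κ → ℝ))

/-! ## §1 Group-level transporter letters read off the bond variables -/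

section Letters

/-- The conjugate `vᴴuv` of a unitary by a unitary is unitary. [folklore] -/
theorem uN_conj_unitary {u v : Matrix n n ℂ} (hu : uᴴ * u = 1) (hv : vᴴ * v = 1) : (vᴴ * u * v)ᴴ * (vᴴ * u * v) = 1 := by
  have hv' : v * vᴴ = 1 := mul_eq_one_comm.mp hv
  rw [Matrix.conjTranspose_mul, Matrix.conjTranspose_mul, Matrix.conjTranspose_conjTranspose]
  calc vᴴ * (uᴴ * v) * (vᴴ * u * v) = vᴴ * (uᴴ * ((v * vᴴ) * u)) * v := by simp only [Matrix.mul_assoc]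
    _ = 1 := by rw [hv', Matrix.one_mul, hu, Matrix.mul_one, hv]

/-- ★ **THE ADJOINT ACTIONS OF TWO UNITARIES DIFFER ENTRYWISE BY AT MOST `κ_e·2√|n|·‖u′ − u‖_F`** in trace-form coordinates (file 5 `abs_coordMat_sub_entry_le`, g4
`uN_opNorm_conj_sub_conj_le`, `‖u‖_F = √|n|` for unitary `u`). [cite: Balaban1985BackgroundPropagators, (3.35) p.396, (3.50) p.400 (shapes)] -/
theorem uN_abs_coordMat_conj_sub_entry_le {u u' : Matrix n n ℂ} (hu : uᴴ * u = 1) (hu' : u'ᴴ * u' = 1) (i j : κ) :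
    |(coordMat e (ContinuousLinearMap.mulLeftRight ℝ (Matrix n n ℂ) u' u'ᴴ) - coordMat e (ContinuousLinearMap.mulLeftRight ℝ (Matrix n n ℂ) u uᴴ)) i j| ≤
      basisConst e * (2 * Real.sqrt (Fintype.card n) * ‖u' - u‖) := by
  refine (abs_coordMat_sub_entry_le e _ _ i j).trans (mul_le_mul_of_nonneg_left ?_ (basisConst_nonneg e))
  calc _ ≤ (‖u'‖ + ‖u‖) * ‖u' - u‖ := uN_opNorm_conj_sub_conj_le u' u
    _ = 2 * Real.sqrt (Fintype.card n) * ‖u' - u‖ := by rw [uN_frobenius_norm_of_unitary hu, uN_frobenius_norm_of_unitary hu']; ring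

/-- `Ad_1 = 1` in coordinates: `coordMat e (X ↦ 1·X·1ᴴ) = 1`. [folklore] -/
theorem coordMat_conj_one : coordMat e (ContinuousLinearMap.mulLeftRight ℝ (Matrix n n ℂ) 1 (1 : Matrix n n ℂ)ᴴ) = 1 := by
  rw [Matrix.conjTranspose_one, mulLeftRight_one_one, coordMat_one]

variable {X J : Type} (η : ℝ) (τ : J → X ≃ X) (U V : J → X → Matrix n n ℂ)

/-- ★ **THE FIELD LETTER AT GROUP LEVEL** (file 1's `hSp`): unitary bond variables with `‖U_μ(x) − 1‖_F ≤ ηa` ⟹ `|(S_μ(x) − 1)_{ij}| ≤ η·(κ_e·2√|n|·a)` for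
`S_μ(x) = coordMat e (Ad_{U_μ(x)})` (any real `η`). [cite: Balaban1985BackgroundPropagators, (3.35) p.396 (first inequality: shape), (3.37) p.396] -/
theorem uN_transporterLetter_group (hU : ∀ μ x, (U μ x)ᴴ * U μ x = 1) {a : ℝ} (hUa : ∀ μ x, ‖U μ x - 1‖ ≤ η * a) (μ : J) (x : X) (i j : κ) :
    |(coordMat e (ContinuousLinearMap.mulLeftRight ℝ (Matrix n n ℂ) (U μ x) (U μ x)ᴴ) - 1) i j| ≤ η * (basisConst e * (2 * Real.sqrt (Fintype.card n)) * a) := by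
  have h1 : (1 : Matrix n n ℂ)ᴴ * 1 = 1 := by rw [Matrix.conjTranspose_one, Matrix.mul_one]
  rw [← coordMat_conj_one e]
  calc _ ≤ basisConst e * (2 * Real.sqrt (Fintype.card n) * ‖U μ x - 1‖) := uN_abs_coordMat_conj_sub_entry_le e h1 (hU μ x) i j
    _ ≤ basisConst e * (2 * Real.sqrt (Fintype.card n) * (η * a)) := by gcongr; exacts [basisConst_nonneg e, hUa μ x]
    _ = η * (basisConst e * (2 * Real.sqrt (Fintype.card n)) * a) := by ring

/-- ★★ **THE COVARIANT BACKWARD DEFECT AT A `U(N)` BASE POINT IS A DIFFERENCE OF TWO ADJOINT ACTIONS**: for unitary background bond variables `V` (`R_μ = coordMat e (Ad_{V_μ})`) and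
perturbation bond variables `U` (`S_μ = coordMat e (Ad_{U_μ})`), `S_μ(x) − R₋ᵀS₋R₋ = coordMat e (Ad_{U_μ(x)}) − coordMat e (Ad_{V₋ᴴU₋V₋})`, `U₋ = U_μ(x − e_μ)`, `V₋ = V_μ(x − e_μ)` —
`R₋ᵀ = coordMat e (Ad_{V₋ᴴ})` (g2 `uN_siteGauge_transpose_eq`) and `Ad` is multiplicative (g2 `coordMat_mulLeftRight_mul`): the print's `D^{η*}_U` acting on the transporters.
[cite: Balaban1985BackgroundPropagators, (3.52) p.400 (shape: `D^{η*}_U A′`), (3.50) p.400] -/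
theorem uN_covShiftDefect_conj_eq (he : ∀ A B : Matrix n n ℂ, traceForm A B = e A ⬝ᵥ e B) (hV : ∀ μ x, (V μ x)ᴴ * V μ x = 1) (μ : J) (x : X) :
    covShiftDefect τ (fun μ x => coordMat e (ContinuousLinearMap.mulLeftRight ℝ (Matrix n n ℂ) (V μ x) (V μ x)ᴴ))
        (fun μ x => coordMat e (ContinuousLinearMap.mulLeftRight ℝ (Matrix n n ℂ) (U μ x) (U μ x)ᴴ)) μ x =
      coordMat e (ContinuousLinearMap.mulLeftRight ℝ (Matrix n n ℂ) (U μ x) (U μ x)ᴴ) -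
        coordMat e (ContinuousLinearMap.mulLeftRight ℝ (Matrix n n ℂ) ((V μ ((τ μ).symm x))ᴴ * U μ ((τ μ).symm x) * V μ ((τ μ).symm x))
          ((V μ ((τ μ).symm x))ᴴ * U μ ((τ μ).symm x) * V μ ((τ μ).symm x))ᴴ) := by
  rw [covShiftDefect, uN_siteGauge_transpose_eq e (V μ) he (hV μ) ((τ μ).symm x), coordMat_mulLeftRight_mul, coordMat_mulLeftRight_mul, Matrix.conjTranspose_mul,
    Matrix.conjTranspose_mul, Matrix.conjTranspose_conjTranspose]

/-- ★★ **THE COVARIANT-GRADIENT LETTER AT GROUP LEVEL** (file 1's `hSq`): unitary `U`, `V` with the group-level covariant backward difference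
`‖U_μ(x) − V₋ᴴU₋V₋‖_F ≤ η²b` ⟹ `|(S_μ(x) − R₋ᵀS₋R₋)_{ij}| ≤ η²·(κ_e·2√|n|·b)`. [cite: Balaban1985BackgroundPropagators, (3.35) p.396 (second inequality: shape), (3.52) p.400] -/
theorem uN_covShiftLetter_group (he : ∀ A B : Matrix n n ℂ, traceForm A B = e A ⬝ᵥ e B) (hU : ∀ μ x, (U μ x)ᴴ * U μ x = 1) (hV : ∀ μ x, (V μ x)ᴴ * V μ x = 1) {b : ℝ}
    (hUb : ∀ μ x, ‖U μ x - (V μ ((τ μ).symm x))ᴴ * U μ ((τ μ).symm x) * V μ ((τ μ).symm x)‖ ≤ η ^ 2 * b) (μ : J) (x : X) (i j : κ) :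
    |covShiftDefect τ (fun μ x => coordMat e (ContinuousLinearMap.mulLeftRight ℝ (Matrix n n ℂ) (V μ x) (V μ x)ᴴ))
        (fun μ x => coordMat e (ContinuousLinearMap.mulLeftRight ℝ (Matrix n n ℂ) (U μ x) (U μ x)ᴴ)) μ x i j| ≤
      η ^ 2 * (basisConst e * (2 * Real.sqrt (Fintype.card n)) * b) := by
  rw [uN_covShiftDefect_conj_eq e τ U V he hV μ x]
  have hW : ((V μ ((τ μ).symm x))ᴴ * U μ ((τ μ).symm x) * V μ ((τ μ).symm x))ᴴ * ((V μ ((τ μ).symm x))ᴴ * U μ ((τ μ).symm x) * V μ ((τ μ).symm x)) = 1 :=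
    uN_conj_unitary (hU μ _) (hV μ _)
  calc _ ≤ basisConst e * (2 * Real.sqrt (Fintype.card n) * ‖U μ x - (V μ ((τ μ).symm x))ᴴ * U μ ((τ μ).symm x) * V μ ((τ μ).symm x)‖) :=
        uN_abs_coordMat_conj_sub_entry_le e hW (hU μ x) i j
    _ ≤ basisConst e * (2 * Real.sqrt (Fintype.card n) * (η ^ 2 * b)) := by gcongr; exacts [basisConst_nonneg e, hUb μ x]
    _ = η ^ 2 * (basisConst e * (2 * Real.sqrt (Fintype.card n)) * b) := by ring

end Letters

/-! ## §2 The knit: `hV` at a genuine `U(N)` pair, and around `U ≡ 1` -/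

section Knit

variable {X J : Type} [Fintype X] [DecidableEq X] [Fintype J] [DecidableEq J] {g : B6.Geometry} (blk : X → g.Site) (η : ℝ) (τ : J → X ≃ X) (U V : J → X → Matrix n n ℂ)

omit [DecidableEq X] [DecidableEq J] in
/-- ★★★ **`hV` FOR THE CURVED SPECIES AT A GENUINE `U(N)` PAIR, NO MODEL HYPOTHESIS**: trace-form-orthonormal `e`; unitary bond variables `U` (perturbation) and `V` (background);
group-level letters `‖U_μ(x) − 1‖_F ≤ ηa`, `‖U_μ(x) − V₋ᴴU₋V₋‖_F ≤ η²b`; `η > 0`, `d(y, y) = 0` ⟹ for `S = coordMat e (Ad_U)`, `R = coordMat e (Ad_V)`: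
`V̂_R(S) ≤ r_V(κ_e 2√|n| a, κ_e 2√|n| b)(1 + |J ⊕ J|)·e^{−δ_Vd}` for every `δ_V` — files 23∕25∕44's slot (orthogonality by g2 `uN_coordMat_conj_orthogonal`, letters by §1).
[cite: Balaban1985BackgroundPropagators, (3.35) p.396, (3.52)–(3.53) p.400, (3.63) p.402 (shapes)] -/
theorem uN_hasMaj_unstackM_curvCoef_group_rate (he : ∀ A B : Matrix n n ℂ, traceForm A B = e A ⬝ᵥ e B) (hU : ∀ μ x, (U μ x)ᴴ * U μ x = 1) (hV : ∀ μ x, (V μ x)ᴴ * V μ x = 1)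
    (hd0 : ∀ y : g.Site, g.dist y y = 0) {a b : ℝ} (hη : 0 < η) (ha : 0 ≤ a) (hb : 0 ≤ b) (hUa : ∀ μ x, ‖U μ x - 1‖ ≤ η * a)
    (hUb : ∀ μ x, ‖U μ x - (V μ ((τ μ).symm x))ᴴ * U μ ((τ μ).symm x) * V μ ((τ μ).symm x)‖ ≤ η ^ 2 * b) (δV : ℝ) :
    HasMaj (BlockNorm.ofBlocks g (blkPair (liftBlk blk κ))) (BlockNorm.ofBlocks g (liftBlk blk κ))
      (unstackM (curvCoefC η τ (fun μ x => coordMat e (ContinuousLinearMap.mulLeftRight ℝ (Matrix n n ℂ) (V μ x) (V μ x)ᴴ))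
          (fun μ x => coordMat e (ContinuousLinearMap.mulLeftRight ℝ (Matrix n n ℂ) (U μ x) (U μ x)ᴴ)))
        (curvCoefA η τ (fun μ x => coordMat e (ContinuousLinearMap.mulLeftRight ℝ (Matrix n n ℂ) (V μ x) (V μ x)ᴴ))
          (fun μ x => coordMat e (ContinuousLinearMap.mulLeftRight ℝ (Matrix n n ℂ) (U μ x) (U μ x)ᴴ))))
      (fun y y' => curvRowLetter κ J (basisConst e * (2 * Real.sqrt (Fintype.card n)) * a) (basisConst e * (2 * Real.sqrt (Fintype.card n)) * b) * (1 + Fintype.card (J ⊕ J)) *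
        Real.exp (-(δV * g.dist y y'))) :=
  have hκ : 0 ≤ basisConst e * (2 * Real.sqrt (Fintype.card n)) := mul_nonneg (basisConst_nonneg e) (by positivity)
  hasMaj_unstackM_curvCoef_rate blk η τ _ _ hd0 hη (mul_nonneg hκ ha) (mul_nonneg hκ hb) (fun μ x => (uN_coordMat_conj_orthogonal e he (hU μ x)).2)
    (fun μ x => (uN_coordMat_conj_orthogonal e he (hV μ x)).1) (fun μ x => (uN_coordMat_conj_orthogonal e he (hV μ x)).2) (uN_transporterLetter_group e η U hU hUa)
    (uN_covShiftLetter_group e η τ U V he hU hV hUb) δV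

omit [DecidableEq X] [DecidableEq J] in
/-- ★★ **`hV` FOR THE SPECIES EDITION AROUND `U ≡ 1` AT A GENUINE `U(N)` FIELD**: unitary bond variables with `‖U_μ(x) − 1‖_F ≤ ηa` and the PLAIN backward difference
`‖U_μ(x) − U_μ(x − e_μ)‖_F ≤ η²b` ⟹ `unstackM (tCoefC η (gaugePair τ S)) (tCoefA η (gaugePair τ S)) ≤ r_V(κ_e 2√|n| a, κ_e 2√|n| b)(1 + |J ⊕ J|)·e^{−δ_Vd}` for `S = coordMat e (Ad_U)`,
every `δ_V` — the perturbation of `Δ_S = Δ_1 − V̂∘jet` for a genuine non-abelian small field in files 20–23's slot. [cite: Balaban1985BackgroundPropagators, (3.35) p.396, (3.52)–(3.53) p.400 (shapes)] -/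
theorem uN_hasMaj_unstackM_tCoef_gaugePair_group_rate (he : ∀ A B : Matrix n n ℂ, traceForm A B = e A ⬝ᵥ e B) (hU : ∀ μ x, (U μ x)ᴴ * U μ x = 1)
    (hd0 : ∀ y : g.Site, g.dist y y = 0) {a b : ℝ} (hη : 0 < η) (ha : 0 ≤ a) (hb : 0 ≤ b) (hUa : ∀ μ x, ‖U μ x - 1‖ ≤ η * a)
    (hUb : ∀ μ x, ‖U μ x - U μ ((τ μ).symm x)‖ ≤ η ^ 2 * b) (δV : ℝ) :
    HasMaj (BlockNorm.ofBlocks g (blkPair (liftBlk blk κ))) (BlockNorm.ofBlocks g (liftBlk blk κ))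
      (unstackM (tCoefC η (gaugePair τ fun μ x => coordMat e (ContinuousLinearMap.mulLeftRight ℝ (Matrix n n ℂ) (U μ x) (U μ x)ᴴ)))
        (tCoefA η (gaugePair τ fun μ x => coordMat e (ContinuousLinearMap.mulLeftRight ℝ (Matrix n n ℂ) (U μ x) (U μ x)ᴴ))))
      (fun y y' => curvRowLetter κ J (basisConst e * (2 * Real.sqrt (Fintype.card n)) * a) (basisConst e * (2 * Real.sqrt (Fintype.card n)) * b) * (1 + Fintype.card (J ⊕ J)) *
        Real.exp (-(δV * g.dist y y'))) := by
  have hκ : 0 ≤ basisConst e * (2 * Real.sqrt (Fintype.card n)) := mul_nonneg (basisConst_nonneg e) (by positivity)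
  refine hasMaj_unstackM_tCoef_gaugePair_rate blk η τ _ hd0 hη (mul_nonneg hκ ha) (mul_nonneg hκ hb) (fun μ x => (uN_coordMat_conj_orthogonal e he (hU μ x)).2)
    (uN_transporterLetter_group e η U hU hUa) (fun μ x i j => ?_) δV
  calc _ ≤ basisConst e * (2 * Real.sqrt (Fintype.card n) * ‖U μ x - U μ ((τ μ).symm x)‖) := uN_abs_coordMat_conj_sub_entry_le e (hU μ _) (hU μ x) i j
    _ ≤ basisConst e * (2 * Real.sqrt (Fintype.card n) * (η ^ 2 * b)) := by gcongr; exacts [basisConst_nonneg e, hUb μ x]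
    _ = η ^ 2 * (basisConst e * (2 * Real.sqrt (Fintype.card n)) * b) := by ring

end Knit

/-! ## §3 Generator level for `𝔲(N)`-valued potentials: `hV` on one grid, `hDV` on two grids, skewness discharged -/

section Generator

variable {X X' J : Type} [Fintype X] [Fintype X'] [DecidableEq X] [DecidableEq X'] [Fintype J] [DecidableEq J] {g : B6.Geometry} (blk : X → g.Site) (π : X' → X)
  (η η' : ℝ) (τ : J → X ≃ X) (τ' : J → X' ≃ X') (A B : J → X → Matrix n n ℂ) (A' B' : J → X' → Matrix n n ℂ)

omit [DecidableEq X] [DecidableEq J] in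
/-- ★★ **`hV` AT GENERATOR LEVEL FOR `𝔲(N)`-VALUED POTENTIALS, NO MODEL HYPOTHESIS**: skew-Hermitian `A` (perturbation) and `B` (background), `Z = ad∘A`, `W = ad∘B`, letters
`‖ad_{A_μ(x)}‖ ≤ r`, `‖ad_{B_μ(x)}‖ ≤ r_B`, `‖ad_{A_μ(x)} − ad_{A_μ(x−e_μ)}‖ ≤ ηg`, regimes `0 < η`, `ηr, ηr_B ≤ 1`, `d(y, y) = 0` ⟹
`V̂ ≤ expRowLetter κ J κ_e r r_B g·(1 + |J ⊕ J|)·e^{−δ_Vd}` for every `δ_V`. [cite: Balaban1985BackgroundPropagators, (3.35)–(3.37) p.396, (3.52) p.400 (shapes)] -/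
theorem uN_hasMaj_unstackM_curvCoef_exp_rate (he : ∀ X Y : Matrix n n ℂ, traceForm X Y = e X ⬝ᵥ e Y) (hA : ∀ μ x, (A μ x)ᴴ = -A μ x) (hB : ∀ μ x, (B μ x)ᴴ = -B μ x)
    (hd0 : ∀ y : g.Site, g.dist y y = 0) {r rB gZ : ℝ} (hη : 0 < η) (hreg : η * r ≤ 1) (hregB : η * rB ≤ 1) (hr : 0 ≤ r) (hrB : 0 ≤ rB) (hgZ : 0 ≤ gZ)
    (hZ : ∀ μ x, ‖adCLM ℝ (A μ x)‖ ≤ r) (hW : ∀ μ x, ‖adCLM ℝ (B μ x)‖ ≤ rB) (hgrad : ∀ μ x, ‖adCLM ℝ (A μ x) - adCLM ℝ (A μ ((τ μ).symm x))‖ ≤ η * gZ) (δV : ℝ) :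
    HasMaj (BlockNorm.ofBlocks g (blkPair (liftBlk blk κ))) (BlockNorm.ofBlocks g (liftBlk blk κ))
      (unstackM (curvCoefC η τ (expTrField e η fun μ x => adCLM ℝ (B μ x)) (expTrField e η fun μ x => adCLM ℝ (A μ x)))
        (curvCoefA η τ (expTrField e η fun μ x => adCLM ℝ (B μ x)) (expTrField e η fun μ x => adCLM ℝ (A μ x))))
      (fun y y' => expRowLetter κ J (basisConst e) r rB gZ * (1 + Fintype.card (J ⊕ J)) * Real.exp (-(δV * g.dist y y'))) :=
  hasMaj_unstackM_curvCoef_exp_rate_of_skew e blk η τ (fun μ x => adCLM ℝ (A μ x)) (fun μ x => adCLM ℝ (B μ x)) hd0 hη hreg hregB hr hrB hgZ hZ hW hgrad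
    (fun μ x => coordMat_adCLM_transpose_eq_neg_of_conjTranspose e he (hA μ x)) (fun μ x => coordMat_adCLM_transpose_eq_neg_of_conjTranspose e he (hB μ x)) δV

omit [DecidableEq X] [DecidableEq X'] [DecidableEq J] in
/-- ★★★ **`hDV` AT GENERATOR LEVEL FOR `𝔲(N)`-VALUED POTENTIALS ON TWO GRIDS, NO MODEL HYPOTHESIS**: skew-Hermitian `A, B` (coarse) and `A′, B′` (fine); sizes, lattice-gradient
letters, the plain ∕ translated ∕ background ∕ derivative two-grid fits of the `ad`-fields (file 7's data), regimes `η₀r, η₀r_B ≤ 1`, `0 < η′ ≤ η ≤ η₀`, `d(y, y) = 0` ⟹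
`𝔇(V̂′, V̂) ≤ expFitLetter κ J κ_e r r_B g o o_t o_W o_D η·(1 + |J ⊕ J|)·e^{−δ_Vd}` for every `δ_V` — files 24∕45's slot at the gauge algebra of record.
[cite: Balaban1985BackgroundPropagators, (3.35)–(3.37) p.396, (3.52) p.400, Thm 3.14 pp.426–427 (shapes)] -/
theorem uN_hasMaj_idef_unstackM_curvCoef_exp_rate (he : ∀ X Y : Matrix n n ℂ, traceForm X Y = e X ⬝ᵥ e Y) (hA : ∀ μ x, (A μ x)ᴴ = -A μ x) (hB : ∀ μ x, (B μ x)ᴴ = -B μ x)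
    (hA' : ∀ μ x', (A' μ x')ᴴ = -A' μ x') (hB' : ∀ μ x', (B' μ x')ᴴ = -B' μ x') (hd0 : ∀ y : g.Site, g.dist y y = 0) {η₀ r rB gZ o ot oW oD : ℝ}
    (hreg : η₀ * r ≤ 1) (hregB : η₀ * rB ≤ 1) (hη' : 0 < η') (hη'η : η' ≤ η) (hηη₀ : η ≤ η₀)
    (hr : 0 ≤ r) (hrB : 0 ≤ rB) (hgZ : 0 ≤ gZ) (ho : 0 ≤ o) (hot : 0 ≤ ot) (hoW : 0 ≤ oW) (hoD : 0 ≤ oD)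
    (hZ : ∀ μ x, ‖adCLM ℝ (A μ x)‖ ≤ r) (hZ' : ∀ μ x', ‖adCLM ℝ (A' μ x')‖ ≤ r) (hW : ∀ μ x, ‖adCLM ℝ (B μ x)‖ ≤ rB) (hW' : ∀ μ x', ‖adCLM ℝ (B' μ x')‖ ≤ rB)
    (hgrad : ∀ μ x, ‖adCLM ℝ (A μ x) - adCLM ℝ (A μ ((τ μ).symm x))‖ ≤ η * gZ) (hgrad' : ∀ μ x', ‖adCLM ℝ (A' μ x') - adCLM ℝ (A' μ ((τ' μ).symm x'))‖ ≤ η' * gZ)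
    (hfit : ∀ μ x', ‖adCLM ℝ (A' μ x') - adCLM ℝ (A μ (π x'))‖ ≤ o) (hfitT : ∀ μ x', ‖adCLM ℝ (A' μ ((τ' μ).symm x')) - adCLM ℝ (A μ ((τ μ).symm (π x')))‖ ≤ ot)
    (hfitW : ∀ μ x', ‖adCLM ℝ (B' μ ((τ' μ).symm x')) - adCLM ℝ (B μ ((τ μ).symm (π x')))‖ ≤ oW)
    (hfitD : ∀ μ x', ‖η'⁻¹ • (adCLM ℝ (A' μ x') - adCLM ℝ (A' μ ((τ' μ).symm x'))) - η⁻¹ • (adCLM ℝ (A μ (π x')) - adCLM ℝ (A μ ((τ μ).symm (π x'))))‖ ≤ oD) (δV : ℝ) :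
    HasMaj (BlockNorm.ofBlocks g (blkPair (liftBlk blk κ))) (BlockNorm.ofBlocks g (liftBlk (blk ∘ π) κ))
      (idef (pull (liftPair (liftMap π κ))) (pull (liftMap π κ))
        (unstackM (curvCoefC η' τ' (expTrField e η' fun μ x' => adCLM ℝ (B' μ x')) (expTrField e η' fun μ x' => adCLM ℝ (A' μ x')))
          (curvCoefA η' τ' (expTrField e η' fun μ x' => adCLM ℝ (B' μ x')) (expTrField e η' fun μ x' => adCLM ℝ (A' μ x'))))
        (unstackM (curvCoefC η τ (expTrField e η fun μ x => adCLM ℝ (B μ x)) (expTrField e η fun μ x => adCLM ℝ (A μ x)))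
          (curvCoefA η τ (expTrField e η fun μ x => adCLM ℝ (B μ x)) (expTrField e η fun μ x => adCLM ℝ (A μ x)))))
      (fun y y' => expFitLetter κ J (basisConst e) r rB gZ o ot oW oD η * (1 + Fintype.card (J ⊕ J)) * Real.exp (-(δV * g.dist y y'))) :=
  hasMaj_idef_unstackM_curvCoef_exp_rate_of_skew e blk π η η' τ τ' (fun μ x => adCLM ℝ (A μ x)) (fun μ x => adCLM ℝ (B μ x)) (fun μ x' => adCLM ℝ (A' μ x'))
    (fun μ x' => adCLM ℝ (B' μ x')) hd0 hreg hregB hη' hη'η hηη₀ hr hrB hgZ ho hot hoW hoD hZ hZ' hW hW' hgrad hgrad' hfit hfitT hfitW hfitD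
    (fun μ x => coordMat_adCLM_transpose_eq_neg_of_conjTranspose e he (hA μ x)) (fun μ x => coordMat_adCLM_transpose_eq_neg_of_conjTranspose e he (hB μ x))
    (fun μ x' => coordMat_adCLM_transpose_eq_neg_of_conjTranspose e he (hA' μ x')) (fun μ x' => coordMat_adCLM_transpose_eq_neg_of_conjTranspose e he (hB' μ x')) δV

end Generator

end Summit.QuantumFields.YangMills.BalabanUVNodes.N15.CurvedSpecies

end
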